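import Literature.NumberTheory.Automorphic.BCDTTheoremBNormalisedAssembly
import Literature.NumberTheory.GaloisRepresentations.DecompositionGroupOfCompletion
import Literature.NumberTheory.Automorphic.AdicCompletionResidueCard
import HarnessLib

/-!
# BCDT Theorem 2.2.1, cases 2–6: the normal form on `G₃ = Gal(ℚ̄₃/ℚ₃)`

Topic `NumberTheory/Automorphic`; a companion of `BCDTTheoremBNormalisedAssembly` and of
`BCDTTheoremBWildAtThree{,Det,Cases,Twist,Normalised}`, landed by the tenured seat of the named fact
`Literature.NumberTheory.Automorphic.BCDT.theoremB` (Breuil–Conrad–Diamond–Taylor 2001, Thm. B =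
Thm. 2.2.1).  Theorems only (no definition, no named fact).

BCDT state the normal form of a wild `ρ̄ : G_ℚ → GL₂(𝔽₅)` (proof of Thm. 2.2.1, p. 860, cases 2–6)
for the LOCAL Galois group: *"`ρ̄|_{G₃}` is given by the character `ℚ₃^× → 𝔽₅(τ)^×` determined by
`3 ↦ τⁱ(τ - τ⁻¹)`, `-1 ↦ 1`, `4 ↦ τ`"* etc., `G₃ = Gal(ℚ̄₃/ℚ₃) ↪ G_ℚ` a decomposition group at `3`.
The tree's normal form `BCDT.IsWildNormalisedAtThree` (`BCDTTheoremBNormalisedAssembly`) is phrased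
on a decomposition group `D_𝔓 ≤ Γ_ℚ`, `𝔓 ∣ 3`.  With the local–global dictionary at the prime
`𝔓₀ = adicCompletionPrime ℚ v₃` of the completion (`DecompositionGroupOfCompletion`:
`D_{𝔓₀} = res Γ_{ℚ₃}`, `I_{𝔓₀} = res I_{ℚ₃}`, Frobenius ↔ Frobenius) and the conjugacy of the primes
above `3`, this file transports it to the local representation
`ρ̄.toLocal v₃ = ρ̄ ∘ res : Γ_{ℚ₃} → GL₂(𝔽₅)` (`FramedGaloisRep.toLocal`, the tree's "`ρ̄|_{G₃}`"):

* `GaloisRepresentations.residueFieldCard_adicCompletion_eq_card_quotient`,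
  `GaloisRepresentations.isArithFrobAt_absGaloisRestrict_adicCompletionPrime_iff'`,
  `GaloisRepresentations.exists_isAbsArithFrob_absGaloisRestrict_eq` — the Frobenius dictionary
  unconditionally, for Mathlib's valued local-field structure of `K_v`
  (`Automorphic/AdicCompletionLocalField`, `…ResidueCard`);
* `BCDT.IsWildNormalisedAtThree.exists_toLocal` — **the normal form of cases 2–6 on
  `Gal(ℚ̄₃/ℚ₃)`**: for a wild-normalised `ρ̄'` there is `x ∈ GL₂(𝔽₅)` such that
  `f = x (ρ̄'|_{G₃}) x⁻¹ : Γ_{ℚ₃} → GL₂(𝔽₅)` takes values in `N(𝔽₅(τ)^×)` and either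
  `f(I_{ℚ₃}) = ⟨τ⟩` ("`4 ↦ τ`, `-1 ↦ 1`": cases 2–3) with, if `f(Γ_{ℚ₃}) ⊆ 𝔽₅(τ)^×` (case 2), an
  arithmetic Frobenius `φ ∈ Γ_{ℚ₃}` (`IsAbsArithFrob`) of value `f φ = ν = τ - τ⁻¹`
  ("`3 ↦ τⁱ(τ - τ⁻¹)`"), or `f(I_{ℚ₃}) = ⟨τ, σ⟩` (cases 4–6) with an arithmetic Frobenius `φ` of value
  `ν` in `𝔽₅(τ)^×` ("`√±3 ↦ τ - τ⁻¹`").  (The image of wild inertia, `⟨τ⟩`, is the Sylow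
  `3`-subgroup of `f(I_{ℚ₃})` in both cases.)  Only the naming of the characters of `ℚ₃^×`,
  `ℚ₃(√-1)^×`, `ℚ₃(√±3)^×` by local class field theory is not carried out.

## References

* C. Breuil, B. Conrad, F. Diamond, R. Taylor, *On the modularity of elliptic curves over `ℚ`: wild
  3-adic exercises*, J. Amer. Math. Soc. 14 (2001), 843–939; proof of Thm. 2.2.1, p. 860.
  [BCDTJAMS2001]
* J. Neukirch, *Algebraic Number Theory* (1999), Ch. II §9, Prop. (9.6). [NeukirchANT1999]
-/

noncomputable section

open scoped NumberField Pointwise Valued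
open IsDedekindDomain Field

universe u

/-! ## The Frobenius dictionary for the valued structure of `K_v` -/

namespace Literature.NumberTheory.GaloisRepresentations

open IsNonarchimedeanLocalField

variable (K : Type u) [Field K] [NumberField K] (v : HeightOneSpectrum (𝓞 K))

/-- `q_{K_v} = #(𝓞 K ⧸ v)` for Mathlib's valued local-field structure of `K_v`
(`residueFieldCard_adicCompletion_eq` and `residueCard_eq_card_quotient`): the hypothesis `hq` of
`isArithFrobAt_absGaloisRestrict_adicCompletionPrime_iff`. [folklore] -/
theorem residueFieldCard_adicCompletion_eq_card_quotient :
    residueFieldCard (v.adicCompletion K) = Nat.card (𝓞 K ⧸ v.asIdeal) := by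
  rw [Automorphic.residueFieldCard_adicCompletion_eq, v.residueCard_eq_card_quotient]

/-- **Frobenius at `𝔓₀` ↔ Frobenius of `K_v`**, unconditionally for the valued structure of `K_v`:
`res σ` is an arithmetic Frobenius at `𝔓₀ = adicCompletionPrime K v` iff `σ ∈ Γ_{K_v}` is an
arithmetic Frobenius of `K_v`.  Neukirch, *Algebraic Number Theory*, Ch. II §9, Prop. (9.6).
[cite: NeukirchANT1999, Ch. II §9 Prop. (9.6)] -/
theorem isArithFrobAt_absGaloisRestrict_adicCompletionPrime_iff'
    (σ : absoluteGaloisGroup (v.adicCompletion K)) :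
    IsArithFrobAt (𝓞 K) (absGaloisRestrict K (v.adicCompletion K) σ) (adicCompletionPrime K v) ↔
      IsAbsArithFrob σ :=
  isArithFrobAt_absGaloisRestrict_adicCompletionPrime_iff K v
    (residueFieldCard_adicCompletion_eq_card_quotient K v) σ

variable {K v} in
/-- **Every arithmetic Frobenius at `𝔓₀` is the restriction of an arithmetic Frobenius of `K_v`**
(it lies in `D_{𝔓₀} = res Γ_{K_v}`). [cite: NeukirchANT1999, Ch. II §9 Prop. (9.6)] -/
theorem exists_isAbsArithFrob_absGaloisRestrict_eq {φ : absoluteGaloisGroup K}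
    (hφ : IsArithFrobAt (𝓞 K) φ (adicCompletionPrime K v)) :
    ∃ φL : absoluteGaloisGroup (v.adicCompletion K),
      IsAbsArithFrob φL ∧ absGaloisRestrict K (v.adicCompletion K) φL = φ := by
  have hD : φ ∈ (adicCompletionPrime K v).decompositionSubgroup (absoluteGaloisGroup K) :=
    hφ.mem_stabilizer
  rw [decompositionSubgroup_adicCompletionPrime_eq_range] at hD
  obtain ⟨φL, rfl⟩ := hD
  exact ⟨φL, (isArithFrobAt_absGaloisRestrict_adicCompletionPrime_iff' K v φL).mp hφ, rfl⟩

end Literature.NumberTheory.GaloisRepresentations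

/-! ## The normal form on `Gal(ℚ̄₃/ℚ₃)` -/

namespace Literature.NumberTheory.Automorphic.BCDT

open GaloisRepresentations GaloisRepresentations.GL2F5OrderThree

/-- Conjugating the frame by `x ρ̄(g)` is conjugating the argument by `g`:
`(x ρ̄ g) ρ̄ σ (x ρ̄ g)⁻¹ = x ρ̄ (g σ g⁻¹) x⁻¹`. [folklore] -/
theorem conj_mul_apply_eq (ρ : ModPGaloisRep ℚ (ZMod 5) 2) (x : GL (Fin 2) (ZMod 5))
    (g σ : absoluteGaloisGroup ℚ) :
    x * ρ g * ρ σ * (x * ρ g)⁻¹ = x * ρ (g * σ * g⁻¹) * x⁻¹ := by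
  rw [map_mul, map_mul, map_inv, mul_inv_rev]
  group

/-- **BCDT's normal form of cases 2–6 on `G₃ = Gal(ℚ̄₃/ℚ₃)`** (proof of Thm. 2.2.1, p. 860:
*"`ρ̄|_{G₃}` is given by the character … `4 ↦ τ`, `-1 ↦ 1`, `3 ↦ τⁱ(τ - τ⁻¹)`"*, resp.
*"`ρ̄|_{G_{ℚ₃(√±3)}}` … `√±3 ↦ τ - τ⁻¹`, `-1 ↦ -1`"*).  If `ρ̄' : Γ_ℚ → GL₂(𝔽₅)` is wild-normalised
at `3` (`IsWildNormalisedAtThree`, the global normal form on a decomposition group `D_𝔓`, `𝔓 ∣ 3`),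
then for the place `v ∣ 3` and the LOCAL representation `ρ̄'|_{G₃} = ρ̄'.toLocal v : Γ_{ℚ₃} → GL₂(𝔽₅)`
(`FramedGaloisRep.toLocal`, restriction along `res : Γ_{ℚ₃} → Γ_ℚ`) there is `x ∈ GL₂(𝔽₅)` with,
for `f = x (ρ̄'|_{G₃}) x⁻¹`: `f(Γ_{ℚ₃}) ⊆ N(𝔽₅(τ)^×)`, and either `f(I_{ℚ₃}) = ⟨τ⟩` (cases 2–3;
`I_{ℚ₃} = absInertia ℚ₃`) with, if `f(Γ_{ℚ₃}) ⊆ 𝔽₅(τ)^×` (case 2), an arithmetic Frobenius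
`φ ∈ Γ_{ℚ₃}` (`IsAbsArithFrob`) of value `f φ = ν = τ - τ⁻¹`; or `f(I_{ℚ₃}) = ⟨τ, σ⟩` (cases 4–6)
with an arithmetic Frobenius `φ` of value `ν ∈ 𝔽₅(τ)^×`.  Proof: the prime `𝔓` of the global normal
form is `g • 𝔓₀` for the prime `𝔓₀` of the completion (`exists_smul_eq_of_mem_primesAbove`); replace
the conjugator `x` by `x ρ̄'(g)` and use `D_{𝔓₀} = res Γ_{ℚ₃}`, `I_{𝔓₀} = res I_{ℚ₃}` and the
Frobenius dictionary (`DecompositionGroupOfCompletion`).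
[cite: BCDTJAMS2001, §2.2 (proof of Thm. 2.2.1, p. 860, cases 2–6)] -/
theorem IsWildNormalisedAtThree.exists_toLocal {ρ : ModPGaloisRep ℚ (ZMod 5) 2}
    (h : IsWildNormalisedAtThree ρ) :
    ∃ v : HeightOneSpectrum (𝓞 ℚ), ((3 : ℕ) : 𝓞 ℚ) ∈ v.asIdeal ∧ ∃ x : GL (Fin 2) (ZMod 5),
      (∀ σ : absoluteGaloisGroup (v.adicCompletion ℚ),
          x * ρ.toLocal v σ * x⁻¹ ∈ Subgroup.normalizer (unitsF5Tau : Set (GL (Fin 2) (ZMod 5)))) ∧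
      (((absInertia (v.adicCompletion ℚ)).map
            ((MulAut.conj x).toMonoidHom.comp (ρ.toLocal v).toMonoidHom) = Subgroup.zpowers tau ∧
          ((∀ σ : absoluteGaloisGroup (v.adicCompletion ℚ), x * ρ.toLocal v σ * x⁻¹ ∈ unitsF5Tau) →
            ∃ φ : absoluteGaloisGroup (v.adicCompletion ℚ),
              IsAbsArithFrob φ ∧ x * ρ.toLocal v φ * x⁻¹ = nu)) ∨
        ((absInertia (v.adicCompletion ℚ)).map
            ((MulAut.conj x).toMonoidHom.comp (ρ.toLocal v).toMonoidHom) =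
              Subgroup.closure {tau, sigma} ∧
          ∃ φ : absoluteGaloisGroup (v.adicCompletion ℚ),
            IsAbsArithFrob φ ∧ x * ρ.toLocal v φ * x⁻¹ ∈ unitsF5Tau ∧ x * ρ.toLocal v φ * x⁻¹ = nu)) := by
  obtain ⟨-, -, v, hv, 𝔓, h𝔓, x, hN, -, -, hcases⟩ := h
  obtain ⟨g, rfl⟩ := HeightOneSpectrum.exists_smul_eq_of_mem_primesAbove_holds
    (adicCompletionPrime_mem_primesAbove ℚ v) h𝔓
  -- the local group lands in `D_{𝔓₀}`, so its `g`-conjugate lands in `D_{g • 𝔓₀}`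
  have hD₀ : ∀ σL : absoluteGaloisGroup (v.adicCompletion ℚ),
      absGaloisRestrict ℚ (v.adicCompletion ℚ) σL ∈
        (adicCompletionPrime ℚ v).decompositionSubgroup (absoluteGaloisGroup ℚ) := fun σL ↦
    absGaloisRestrict_mem_decompositionSubgroup_of_forall_mem_iff (adicCompletionPrime ℚ v)
      (mem_adicCompletionPrime_iff ℚ v) σL
  have hD : ∀ σL : absoluteGaloisGroup (v.adicCompletion ℚ),
      g * absGaloisRestrict ℚ (v.adicCompletion ℚ) σL * g⁻¹ ∈
        (g • adicCompletionPrime ℚ v).decompositionSubgroup (absoluteGaloisGroup ℚ) := by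
    intro σL
    change g * absGaloisRestrict ℚ (v.adicCompletion ℚ) σL * g⁻¹ ∈
      MulAction.stabilizer (absoluteGaloisGroup ℚ) (g • adicCompletionPrime ℚ v)
    rw [MulAction.stabilizer_smul_eq_stabilizer_map_conj]
    exact ⟨absGaloisRestrict ℚ (v.adicCompletion ℚ) σL, hD₀ σL, by
      rw [MulEquiv.coe_toMonoidHom, MulAut.conj_apply]⟩
  -- `I_{𝔓₀} = res I_L`
  have hI₀ : (adicCompletionPrime ℚ v).inertia (absoluteGaloisGroup ℚ) =
      (absInertia (v.adicCompletion ℚ)).map (absGaloisRestrict ℚ (v.adicCompletion ℚ)).toMonoidHom :=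
    inertia_adicCompletionPrime_eq_map_absInertia ℚ v
  -- values of the new frame `x ρ g`
  have hval : ∀ σL : absoluteGaloisGroup (v.adicCompletion ℚ),
      x * ρ g * ρ.toLocal v σL * (x * ρ g)⁻¹ =
        x * ρ (g * absGaloisRestrict ℚ (v.adicCompletion ℚ) σL * g⁻¹) * x⁻¹ := fun σL ↦ by
    rw [FramedGaloisRep.toLocal_apply, conj_mul_apply_eq]
  -- the image of local inertia in the new frame is the image of `I_{g • 𝔓₀}` in the old one
  have hIeq : (absInertia (v.adicCompletion ℚ)).map
        ((MulAut.conj (x * ρ g)).toMonoidHom.comp (ρ.toLocal v).toMonoidHom) =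
      ((g • adicCompletionPrime ℚ v).inertia (absoluteGaloisGroup ℚ)).map
        ((MulAut.conj x).toMonoidHom.comp ρ.toMonoidHom) := by
    ext y
    rw [Subgroup.mem_map, Subgroup.mem_map]
    constructor
    · rintro ⟨i, hi, rfl⟩
      refine ⟨g * absGaloisRestrict ℚ (v.adicCompletion ℚ) i * g⁻¹, ?_, ?_⟩
      · rw [EllipticCurves.mem_inertia_smul_iff_conj_mem,
          show g⁻¹ * (g * absGaloisRestrict ℚ (v.adicCompletion ℚ) i * g⁻¹) * g =
            absGaloisRestrict ℚ (v.adicCompletion ℚ) i by group, hI₀, Subgroup.mem_map]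
        exact ⟨i, hi, rfl⟩
      · change x * ρ (g * absGaloisRestrict ℚ (v.adicCompletion ℚ) i * g⁻¹) * x⁻¹ =
          x * ρ g * ρ.toLocal v i * (x * ρ g)⁻¹
        rw [hval]
    · rintro ⟨j, hj, rfl⟩
      rw [EllipticCurves.mem_inertia_smul_iff_conj_mem, hI₀, Subgroup.mem_map] at hj
      obtain ⟨i, hi, hi'⟩ := hj
      refine ⟨i, hi, ?_⟩
      change x * ρ g * ρ.toLocal v i * (x * ρ g)⁻¹ = x * ρ j * x⁻¹
      rw [hval, show absGaloisRestrict ℚ (v.adicCompletion ℚ) i = g⁻¹ * j * g from hi',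
        show g * (g⁻¹ * j * g) * g⁻¹ = j by group]
  -- a global Frobenius at `g • 𝔓₀` of value `ν` gives a local one of value `ν` in the new frame
  have hFrob : ∀ φ : absoluteGaloisGroup ℚ, IsArithFrobAt (𝓞 ℚ) φ (g • adicCompletionPrime ℚ v) →
      ∃ φL : absoluteGaloisGroup (v.adicCompletion ℚ), IsAbsArithFrob φL ∧
        x * ρ g * ρ.toLocal v φL * (x * ρ g)⁻¹ = x * ρ φ * x⁻¹ := by
    intro φ hφ
    have hφ' : IsArithFrobAt (𝓞 ℚ) (g⁻¹ * φ * g⁻¹⁻¹) (g⁻¹ • g • adicCompletionPrime ℚ v) :=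
      hφ.conj g⁻¹
    rw [inv_inv, inv_smul_smul] at hφ'
    obtain ⟨φL, hφL, hres⟩ := exists_isAbsArithFrob_absGaloisRestrict_eq hφ'
    refine ⟨φL, hφL, ?_⟩
    rw [hval, hres, show g * (g⁻¹ * φ * g) * g⁻¹ = φ by group]
  refine ⟨v, hv, x * ρ g, fun σL ↦ ?_, ?_⟩
  · rw [hval]
    exact hN _ (hD σL)
  rcases hcases with ⟨hI, hF⟩ | ⟨hI, φ, hφ, hφH, hφν⟩
  · -- cases 2–3
    refine Or.inl ⟨by rw [hIeq, hI], fun hC ↦ ?_⟩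
    -- `f(Γ_L) ⊆ 𝔽₅(τ)^×` gives `D_{g • 𝔓₀} ≤ H`
    have hDH : (g • adicCompletionPrime ℚ v).decompositionSubgroup (absoluteGaloisGroup ℚ) ≤
        unitsF5Tau.comap ((MulAut.conj x).toMonoidHom.comp ρ.toMonoidHom) := by
      intro δ hδ
      change δ ∈ MulAction.stabilizer (absoluteGaloisGroup ℚ) (g • adicCompletionPrime ℚ v) at hδ
      rw [MulAction.stabilizer_smul_eq_stabilizer_map_conj] at hδ
      obtain ⟨δ₀, hδ₀, rfl⟩ := hδ
      have hδ₀' : δ₀ ∈ (adicCompletionPrime ℚ v).decompositionSubgroup (absoluteGaloisGroup ℚ) := hδ₀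
      rw [decompositionSubgroup_adicCompletionPrime_eq_range] at hδ₀'
      obtain ⟨σL, hσL⟩ := hδ₀'
      change x * ρ ((MulAut.conj g).toMonoidHom δ₀) * x⁻¹ ∈ unitsF5Tau
      rw [← hσL, MulEquiv.coe_toMonoidHom, MulAut.conj_apply]
      change x * ρ (g * absGaloisRestrict ℚ (v.adicCompletion ℚ) σL * g⁻¹) * x⁻¹ ∈ unitsF5Tau
      rw [← hval]
      exact hC σL
    obtain ⟨φ, hφ, hφν⟩ := hF hDH
    obtain ⟨φL, hφL, hφLval⟩ := hFrob φ hφ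
    exact ⟨φL, hφL, by rw [hφLval, hφν]⟩
  · -- cases 4–6
    refine Or.inr ⟨by rw [hIeq, hI], ?_⟩
    obtain ⟨φL, hφL, hφLval⟩ := hFrob φ hφ
    refine ⟨φL, hφL, ?_, by rw [hφLval, hφν]⟩
    rw [hφLval]
    exact hφH

end Literature.NumberTheory.Automorphic.BCDT

end
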